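import Summits.QuantumFields.YangMills.Theorems.LuscherReductionDressedRitzPolyakovLiftCouplingSymmetry
import Summits.QuantumFields.YangMills.Theorems.FemtoTransferGapReflection
import Summits.QuantumFields.YangMills.Theorems.FemtoTransferGapSlabFlowLiftReflection
import HarnessLib

/-!
# Line «polyakovlift» on crux `DressedRitz` (stmt-QuantumFields-20205), stub S-STAT: the two-time forms of flowed Polyakov insertions are invariant
# under the REFLECTION `Θ'`, and a GENERAL SEPARATION LEMMA — channels separated by any finite symmetry family are exactly uncorrelated at all times

Fleet-service module of seat ym-infvol-p1 g6 (route `LuscherReduction`, femto rung R2b1; bears on the crux child `DressedRitz` = stmt-QuantumFields-20205,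
skeleton r4 `11e28270fd13c0fc`, stub S-STAT `stub_liftStatics`).  Sequel of `…PolyakovLiftCouplingSymmetry.lean` (seat g5: the two-time forms
`B_{a,b}(f,h) = ⟨K_β^a u_f, K_β^b u_h⟩` of the channel vectors `u_f = ins_φ(f∘Π_t)` are invariant under the AXIS PERMUTATIONS `S₃`; symmetry zeros
for invariant ∕ sign-type ∕ doublet pairs).  This module

* §1 adds the REFLECTION `Θ'` (`…FemtoTransferGapReflection.lean`, `…SlabFlowLiftReflection.lean`): `ins_flowLiftAt_comp_negReflect_eq`
  (`u_{f∘Θ'₁} = u_f ∘ Θ'`), ★ `l2_iterIns_comp_negReflect` (`B_{a,b}(f∘Θ'₁, h∘Θ'₁) = B_{a,b}(f,h)` for every raw vacuum, all `a, b`, every flow time);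
  with `S₃` this makes the forms invariant under the full HYPEROCTAHEDRAL group `O_h` (order 48) of the cubic lattice — the group under which the
  femto-universe levels are classified (`A₁^±, A₂^±, E^±, T₁^±, T₂^±`) [cite: Luscher1983, §2] [cite: LuscherMunster1984, §2];
* §2 proves the averaging identity for an ARBITRARY finite family of one-site maps (`sum_weight_l2_flowLiftAt_eq`, `sum_weight_l2_iterIns_eq`) and
  ★★ the GENERAL SEPARATION LEMMA `l2_iterIns_eq_zero_of_twirl`: if a finite family `γ_j` of one-site maps (closed under an involutive inverse
  pairing `ι`) leaves the two-time forms invariant and preserves physicality, and a symmetric weight `a = a ∘ ι` REPRODUCES `f` (`Σ_j a_j f∘γ_j = f`)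
  and ANNIHILATES `h` (`Σ_j a_j h∘γ_j = 0`), then `B_{a,b}(f,h) = 0` for all `a, b` — with `a_j = (dim α/|Γ|)·χ_α(γ_j)` this is «`f` in the isotypic
  component `α`, `h` without `α`-component ⇒ exactly uncorrelated»; g5's invariant∕sign zeros are the cases `χ = 1`, `χ = sign` of `S₃`;
* §3 packages the consequence for the registered (dressed) family: ★ `dressedLiftFamily_o2_o6_of_twirl` — clause (o2) of `StaticClauses` AND clause
  (o6) of `DynamicCoreClauses` hold with ANY `C ≥ 0` for a twirl-separated pair of a lift basis; ★ `dressedLiftFamily_o2_o6_of_parity` — the first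
  instance beyond `S₃`: a `Θ'₁`-EVEN channel and a `Θ'₁`-ODD channel (one-site functions even∕odd under inversion of the link along axis `0`) are
  exactly uncorrelated at all Euclidean separations.

CONSEQUENCE FOR S-STAT ∕ S-POS: the open content of (o2)∕(o6) is confined to pairs of channels inside ONE isotypic class of the hyperoctahedral
group (e.g. two `A₁⁺` levels), not merely of `S₃` (under which a `T₂⁺` level and an `A₁⁺` level are indistinguishable).  HONEST FRAMING: fixed-lattice
symmetry bookkeeping on the conditional femto rung R2b1; no renormalisation-group content; nothing here bears on infinite volume, the continuum limit
or the Clay gap.  References: M. Lüscher, NPB 219 (1983) 233, §2–3 [cite: Luscher1983, §2]; M. Lüscher, G. Münster, NPB 232 (1984) 445, §2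
[cite: LuscherMunster1984, §2]; M. Lüscher, U. Wolff, NPB 339 (1990) 222 [cite: LuscherWolff1990].
-/

set_option autoImplicit false

noncomputable section

open MeasureTheory Filter Topology Real
open Literature.MathematicalPhysics.QuantumFieldTheory
open scoped BigOperators

namespace Summit.QuantumFields.YangMills.Theorems.FemtoTransferGap.PolyakovLift

open Summit.QuantumFields.YangMills.Theorems.FemtoTransferGap

/-! ## §1 The channel vectors are `Θ'`-equivariant; the two-time forms are `Θ'`-invariant -/

section Reflection

variable {L : ℕ} [NeZero L]

/-- One-point invariance: `⟨φ, ((f∘Θ'₁)∘Π_t)φ⟩ = ⟨φ, (f∘Π_t)φ⟩` for a raw vacuum `φ` (`φ ∘ Θ' = φ`, `Θ'` measure preserving, flowed lift equivariant).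
[cite: Luscher1983, §2] -/
theorem l2_vac_flowLiftAt_comp_negReflect (β : ℝ) {φ : GaugeConfig 3 L SU2 → ℝ} (hφ : IsPhys φ)
    (heig : transferApply β φ = levelValue su2Rep L β 0 • φ) (t : ℝ) (f : GaugeConfig 3 1 SU2 → ℝ) :
    l2 φ (flowLiftAt 0 t (fun V => f V.negReflect) * φ) = l2 φ (flowLiftAt 0 t f * φ) := by
  have hφP : ∀ U : GaugeConfig 3 L SU2, φ U.negReflect = φ U := rawVacuum_comp_negReflect β hφ heig
  rw [← flowLiftAt_zero_comp_negReflect]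
  unfold l2
  have hfun : (fun U => φ U * (((fun U : GaugeConfig 3 L SU2 => flowLiftAt 0 t f U.negReflect) * φ) U)) =
      fun U => (fun V => φ V * ((flowLiftAt (L := L) 0 t f * φ) V)) U.negReflect := by
    funext U; simp only [Pi.mul_apply, hφP]
  rw [hfun]
  exact (measurePreserving_negReflectEquiv (G := SU2)).integral_comp' (f := WilsonSiteRP.negReflectEquiv)
    (fun V => φ V * ((flowLiftAt (L := L) 0 t f * φ) V))

/-- **`u_{f∘Θ'₁} = u_f ∘ Θ'`** for a raw vacuum `φ`: the channel vector of the reflected one-site function is the reflected channel vector.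
[cite: Luscher1983, §2] -/
theorem ins_flowLiftAt_comp_negReflect_eq (β : ℝ) {φ : GaugeConfig 3 L SU2 → ℝ} (hφ : IsPhys φ)
    (heig : transferApply β φ = levelValue su2Rep L β 0 • φ) (t : ℝ) (f : GaugeConfig 3 1 SU2 → ℝ) :
    OpPlat.ins φ (flowLiftAt 0 t fun V => f V.negReflect) = fun U => OpPlat.ins φ (flowLiftAt 0 t f) U.negReflect := by
  have hvev := l2_vac_flowLiftAt_comp_negReflect β hφ heig t f
  funext U
  simp only [OpPlat.ins, Pi.mul_apply, Pi.sub_apply, hvev, rawVacuum_comp_negReflect β hφ heig U, flowLiftAt_zero_negReflect]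

/-- ★ **The two-time forms are `Θ'`-invariant**: `⟨K^a u_{f∘Θ'₁}, K^b u_{h∘Θ'₁}⟩ = ⟨K^a u_f, K^b u_h⟩` for a raw vacuum `φ`, every `a b : ℕ` and every
flow time. [cite: Luscher1983, §2] -/
theorem l2_iterIns_comp_negReflect (β : ℝ) {φ : GaugeConfig 3 L SU2 → ℝ} (hφ : IsPhys φ)
    (heig : transferApply β φ = levelValue su2Rep L β 0 • φ) (t : ℝ) (f h : GaugeConfig 3 1 SU2 → ℝ) (a b : ℕ) :
    l2 ((transferApply β)^[a] (OpPlat.ins φ (flowLiftAt 0 t fun V => f V.negReflect)))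
        ((transferApply β)^[b] (OpPlat.ins φ (flowLiftAt 0 t fun V => h V.negReflect))) =
      l2 ((transferApply β)^[a] (OpPlat.ins φ (flowLiftAt 0 t f))) ((transferApply β)^[b] (OpPlat.ins φ (flowLiftAt 0 t h))) := by
  rw [ins_flowLiftAt_comp_negReflect_eq β hφ heig t f, ins_flowLiftAt_comp_negReflect_eq β hφ heig t h,
    iterate_transferApply_comp_negReflect, iterate_transferApply_comp_negReflect, l2_comp_negReflect]

end Reflection

/-! ## §2 Averaging over an arbitrary finite family of one-site maps; ★★ the general separation lemma -/

section Twirl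

variable {L : ℕ} [NeZero L] {J : Type*} [Fintype J]

/-- Averaging identity, one-point level: if `Σ_j w_j·h(γ_j V) = H(V)` for all `V`, then for physical fine `X`, `φ` and flow time `t`,
`Σ_j w_j ⟨X, ((h∘γ_j)∘Π_t)·φ⟩ = ⟨X, (H∘Π_t)·φ⟩` (push the finite sum inside the integral). [folklore] -/
theorem sum_weight_l2_flowLiftAt_eq {φ X : GaugeConfig 3 L SU2 → ℝ} (hφ : IsPhys φ) (hX : IsPhys X) (t : ℝ)
    {h H : GaugeConfig 3 1 SU2 → ℝ} (γ : J → GaugeConfig 3 1 SU2 → GaugeConfig 3 1 SU2)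
    (hh : ∀ j, IsPhys fun V => h (γ j V)) (w : J → ℝ)
    (hsum : ∀ V, ∑ j, w j * h (γ j V) = H V) :
    ∑ j, w j * l2 X (flowLiftAt 0 t (fun V => h (γ j V)) * φ) = l2 X (flowLiftAt 0 t H * φ) := by
  have hint : ∀ j ∈ (Finset.univ : Finset J),
      Integrable (fun U => w j * (X U * ((flowLiftAt (L := L) 0 t (fun V => h (γ j V)) * φ) U))) (configMeasure SU2 L) :=
    fun j _ => (hX.integrable_mul (OpPlat.isPhys_mul (isPhys_flowLiftAt 0 t (hh j)) hφ)).const_mul _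
  unfold l2
  simp_rw [← integral_const_mul]
  rw [← integral_finsetSum _ hint]
  refine integral_congr_ae (ae_of_all _ fun U => ?_)
  have hterm : ∀ j : J, w j * (X U * ((flowLiftAt (L := L) 0 t (fun V => h (γ j V)) * φ) U)) =
      X U * φ U * (w j * h (γ j (polyakovSite 0 (wilsonFlow t U)))) := fun j => by
    simp only [Pi.mul_apply, flowLiftAt]; ring
  have lhs : ∑ j, w j * (X U * ((flowLiftAt (L := L) 0 t (fun V => h (γ j V)) * φ) U)) =
      X U * φ U * H (polyakovSite 0 (wilsonFlow t U)) := by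
    rw [Finset.sum_congr rfl fun j _ => hterm j, ← Finset.mul_sum, hsum]
  show ∑ j, w j * (X U * ((flowLiftAt (L := L) 0 t (fun V => h (γ j V)) * φ) U)) = X U * ((flowLiftAt (L := L) 0 t H * φ) U)
  rw [lhs]
  simp only [Pi.mul_apply, flowLiftAt]
  ring

/-- Averaging identity, two-time level: if `Σ_j w_j·h(γ_j V) = H(V)` for all `V`, then for physical fine `X`,
`Σ_j w_j ⟨X, K^b u_{h∘γ_j}⟩ = ⟨X, K^b u_H⟩`. [folklore] -/
theorem sum_weight_l2_iterIns_eq (β : ℝ) {φ X : GaugeConfig 3 L SU2 → ℝ} (hφ : IsPhys φ) (hX : IsPhys X) (t : ℝ)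
    {h H : GaugeConfig 3 1 SU2 → ℝ} (hH : IsPhys H) (γ : J → GaugeConfig 3 1 SU2 → GaugeConfig 3 1 SU2)
    (hh : ∀ j, IsPhys fun V => h (γ j V)) (w : J → ℝ) (b : ℕ)
    (hsum : ∀ V, ∑ j, w j * h (γ j V) = H V) :
    ∑ j, w j * l2 X ((transferApply β)^[b] (OpPlat.ins φ (flowLiftAt 0 t fun V => h (γ j V)))) =
      l2 X ((transferApply β)^[b] (OpPlat.ins φ (flowLiftAt 0 t H))) := by
  set Y : GaugeConfig 3 L SU2 → ℝ := (transferApply β)^[b] X with hY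
  have hYp : IsPhys Y := isPhys_iterate_transferApply β hX b
  -- `⟨X, K^b ins φ F⟩ = ⟨Y, Fφ⟩ − ⟨φ, Fφ⟩⟨Y, φ⟩` for any physical one-site-lifted `F`
  have hterm : ∀ {F : GaugeConfig 3 L SU2 → ℝ}, IsPhys F →
      l2 X ((transferApply β)^[b] (OpPlat.ins φ F)) = l2 Y (F * φ) - l2 φ (F * φ) * l2 Y φ := fun {F} hF => by
    have hu : IsPhys (OpPlat.ins φ F) := OpPlat.isPhys_ins hφ hF
    have h0 := l2_iterate_left_right β hX hu b 0
    simp only [Function.iterate_zero, id_eq, zero_add] at h0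
    rw [h0, ← hY, OpPlat.ins_eq, l2_comm, sub_eq_add_neg, ← neg_smul,
      l2_add_left (OpPlat.isPhys_mul hF hφ) (hφ.smul _) hYp, l2_smul_left, l2_comm (F * φ), l2_comm φ Y]
    ring
  have htermj : ∀ j : J, l2 X ((transferApply β)^[b] (OpPlat.ins φ (flowLiftAt 0 t fun V => h (γ j V)))) =
      l2 Y (flowLiftAt 0 t (fun V => h (γ j V)) * φ) - l2 φ (flowLiftAt 0 t (fun V => h (γ j V)) * φ) * l2 Y φ :=
    fun j => hterm (isPhys_flowLiftAt 0 t (hh j))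
  simp_rw [htermj, mul_sub, Finset.sum_sub_distrib]
  have h1 := sum_weight_l2_flowLiftAt_eq hφ hYp t γ hh w hsum
  have h2 := sum_weight_l2_flowLiftAt_eq hφ hφ t γ hh w hsum
  have h3 : ∑ j, w j * (l2 φ (flowLiftAt 0 t (fun V => h (γ j V)) * φ) * l2 Y φ) =
      (∑ j, w j * l2 φ (flowLiftAt 0 t (fun V => h (γ j V)) * φ)) * l2 Y φ := by
    rw [Finset.sum_mul]; exact Finset.sum_congr rfl fun j _ => by ring
  rw [h1, h3, h2, hterm (isPhys_flowLiftAt 0 t hH)]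

/-- The two-time form against the ZERO one-site function vanishes: `⟨X, K^b u_0⟩ = 0`. [folklore] -/
theorem l2_iterIns_zero_fun (β : ℝ) {φ X : GaugeConfig 3 L SU2 → ℝ} (hφ : IsPhys φ) (hX : IsPhys X) (t : ℝ) (b : ℕ) :
    l2 X ((transferApply β)^[b] (OpPlat.ins φ (flowLiftAt 0 t fun _ : GaugeConfig 3 1 SU2 => (0 : ℝ)))) = 0 := by
  -- the empty family: `Σ_{j ∈ ∅} … = 0` reproduces the zero function
  have h := sum_weight_l2_iterIns_eq (J := Fin 0) β hφ hX t (h := fun _ => (0 : ℝ)) (H := fun _ => (0 : ℝ)) (isPhys_const 0)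
    (fun _ V => V) (fun _ => isPhys_const 0) (fun _ => 0) b (fun V => by simp)
  simpa using h.symm

/-- ★★ **GENERAL SEPARATION LEMMA.**  Let `γ_j` (`j ∈ J`, finite) be one-site maps with an involutive inverse pairing `ι` (`γ_j ∘ γ_{ι j} = id`), each
preserving physicality and leaving the two-time forms `B_{a,b}(F,H) = ⟨K_β^a u_F, K_β^b u_H⟩` invariant (raw vacuum `φ`, flow time `t`).  If a weight
`w` with `w ∘ ι = w` REPRODUCES the physical one-site function `f` (`Σ_j w_j f(γ_j V) = f V`) and ANNIHILATES `h` (`Σ_j w_j h(γ_j V) = 0`), then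
`B_{a,b}(f,h) = 0`.  (With `w = (dim α/|Γ|)χ_α` on a finite group `Γ`: `f` in the isotypic component `α`, `h` without `α`-component.)  Proof:
`B(f,h) = Σ_j w_j B(f∘γ_j, h) = Σ_j w_j B(f, h∘γ_{ιj}) = Σ_j w_j B(f, h∘γ_j) = B(f, Σ_j w_j h∘γ_j) = 0`. [cite: Luscher1983, §2] [cite: LuscherWolff1990] -/
theorem l2_iterIns_eq_zero_of_twirl (β : ℝ) {φ : GaugeConfig 3 L SU2 → ℝ} (hφ : IsPhys φ) (t : ℝ)
    (γ : J → GaugeConfig 3 1 SU2 → GaugeConfig 3 1 SU2) (ι : J ≃ J) (hγι : ∀ j V, γ j (γ (ι j) V) = V)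
    (hphys : ∀ j (F : GaugeConfig 3 1 SU2 → ℝ), IsPhys F → IsPhys fun V => F (γ j V))
    (a b : ℕ)
    (hinv : ∀ j (F H : GaugeConfig 3 1 SU2 → ℝ), IsPhys F → IsPhys H →
      l2 ((transferApply β)^[a] (OpPlat.ins φ (flowLiftAt (L := L) 0 t fun V => F (γ j V))))
          ((transferApply β)^[b] (OpPlat.ins φ (flowLiftAt 0 t fun V => H (γ j V)))) =
        l2 ((transferApply β)^[a] (OpPlat.ins φ (flowLiftAt (L := L) 0 t F))) ((transferApply β)^[b] (OpPlat.ins φ (flowLiftAt 0 t H))))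
    (w : J → ℝ) (hw : ∀ j, w (ι j) = w j)
    {f h : GaugeConfig 3 1 SU2 → ℝ} (hf : IsPhys f) (hh : IsPhys h)
    (hfix : ∀ V, ∑ j, w j * f (γ j V) = f V) (hann : ∀ V, ∑ j, w j * h (γ j V) = 0) :
    l2 ((transferApply β)^[a] (OpPlat.ins φ (flowLiftAt (L := L) 0 t f))) ((transferApply β)^[b] (OpPlat.ins φ (flowLiftAt 0 t h))) = 0 := by
  set B : (GaugeConfig 3 1 SU2 → ℝ) → (GaugeConfig 3 1 SU2 → ℝ) → ℝ := fun F H =>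
    l2 ((transferApply β)^[a] (OpPlat.ins φ (flowLiftAt (L := L) 0 t F))) ((transferApply β)^[b] (OpPlat.ins φ (flowLiftAt 0 t H))) with hB
  have hXh : IsPhys ((transferApply β)^[b] (OpPlat.ins φ (flowLiftAt (L := L) 0 t h))) :=
    isPhys_iterate_transferApply β (OpPlat.isPhys_ins hφ (isPhys_flowLiftAt 0 t hh)) b
  have hXf : IsPhys ((transferApply β)^[a] (OpPlat.ins φ (flowLiftAt (L := L) 0 t f))) :=
    isPhys_iterate_transferApply β (OpPlat.isPhys_ins hφ (isPhys_flowLiftAt 0 t hf)) a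
  -- Step 1: `B(f,h) = Σ_j w_j B(f∘γ_j, h)` (reproduce `f` by its twirl, in the first slot via symmetry of `l2`)
  have step1 : B f h = ∑ j, w j * B (fun V => f (γ j V)) h := by
    have hs := sum_weight_l2_iterIns_eq β hφ hXh t hf γ (fun j => hphys j f hf) w a hfix
    simp only [hB]
    rw [l2_comm, ← hs]
    exact Finset.sum_congr rfl fun j _ => by rw [l2_comm]
  -- Step 2: `B(f∘γ_j, h) = B(f, h∘γ_{ιj})` (invariance under `γ_{ιj}` and `γ_j ∘ γ_{ιj} = id`)
  have step2 : ∀ j, B (fun V => f (γ j V)) h = B f (fun V => h (γ (ι j) V)) := fun j => by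
    have hi := hinv (ι j) (fun V => f (γ j V)) h (hphys j f hf) hh
    simp only [hγι] at hi
    simp only [hB]
    exact hi.symm
  -- Step 3: reindex by `ι` and annihilate `h`
  have step3 : ∑ j, w j * B f (fun V => h (γ (ι j) V)) = ∑ j, w j * B f (fun V => h (γ j V)) := by
    have := Equiv.sum_comp ι (fun j => w j * B f (fun V => h (γ j V)))
    rw [← this]
    exact Finset.sum_congr rfl fun j _ => by rw [hw]
  have step4 : ∑ j, w j * B f (fun V => h (γ j V)) = 0 := by
    have hs := sum_weight_l2_iterIns_eq β hφ hXf t (isPhys_const 0) γ (fun j => hphys j h hh) w b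
      (H := fun _ => (0 : ℝ)) hann
    simp only [hB]
    rw [hs]
    exact l2_iterIns_zero_fun β hφ hXf t b
  have : B f h = 0 := by
    rw [step1]
    simp_rw [step2]
    rw [step3, step4]
  simpa only [hB] using this

end Twirl

/-! ## §3 ★ Consequences for the registered (dressed) family: (o2) and (o6) with ANY constant for twirl-separated pairs; parity -/

section Dressed

variable {L : ℕ} [NeZero L] {J : Type*} [Fintype J]

/-- The dressed two-point numbers are two-time forms at flow time `L²/√λ` and dressing `m = dressSteps L`. [folklore] -/
theorem l2_dressed_eq_iterIns (β : ℝ) (φ : GaugeConfig 3 L SU2 → ℝ) {k : ℕ} (g : Fin k → (GaugeConfig 3 1 SU2 → ℝ)) (i l : Fin k) :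
    l2 (dressedLiftFamily β φ g i) (dressedLiftFamily β φ g l) =
      l2 ((transferApply β)^[dressSteps L] (OpPlat.ins φ (flowLiftAt 0 (flowTime β L) (g i))))
        ((transferApply β)^[dressSteps L] (OpPlat.ins φ (flowLiftAt 0 (flowTime β L) (g l)))) := rfl

/-- ★ **Twirl-separated channels of the dressed family are exactly uncorrelated and uncoupled**: `⟨u'_i, u'_l⟩ = 0`, `⟨u'_i, K_β u'_l⟩ = 0`,
`⟨u'_l, K_β u'_i⟩ = 0` whenever `g_i` is reproduced and `g_l` annihilated by a symmetric twirl over a finite family of one-site symmetries of the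
two-time forms (`l2_iterIns_eq_zero_of_twirl` at `(m,m)`, `(m,m+1)`, `(m+1,m)`). [cite: Luscher1983, §2] -/
theorem l2_dressed_pair_eq_zero_of_twirl (β : ℝ) {φ : GaugeConfig 3 L SU2 → ℝ} (hφ : IsPhys φ)
    (γ : J → GaugeConfig 3 1 SU2 → GaugeConfig 3 1 SU2) (ι : J ≃ J) (hγι : ∀ j V, γ j (γ (ι j) V) = V)
    (hphys : ∀ j (F : GaugeConfig 3 1 SU2 → ℝ), IsPhys F → IsPhys fun V => F (γ j V))
    (hinv : ∀ j (F H : GaugeConfig 3 1 SU2 → ℝ), IsPhys F → IsPhys H → ∀ a b : ℕ,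
      l2 ((transferApply β)^[a] (OpPlat.ins φ (flowLiftAt (L := L) 0 (flowTime β L) fun V => F (γ j V))))
          ((transferApply β)^[b] (OpPlat.ins φ (flowLiftAt 0 (flowTime β L) fun V => H (γ j V)))) =
        l2 ((transferApply β)^[a] (OpPlat.ins φ (flowLiftAt (L := L) 0 (flowTime β L) F)))
          ((transferApply β)^[b] (OpPlat.ins φ (flowLiftAt 0 (flowTime β L) H))))
    (w : J → ℝ) (hw : ∀ j, w (ι j) = w j)
    {k : ℕ} {g : Fin k → (GaugeConfig 3 1 SU2 → ℝ)} (hg : ∀ j, IsPhys (g j)) (i l : Fin k)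
    (hfix : ∀ V, ∑ j, w j * g i (γ j V) = g i V) (hann : ∀ V, ∑ j, w j * g l (γ j V) = 0) :
    l2 (dressedLiftFamily β φ g i) (dressedLiftFamily β φ g l) = 0 ∧
      l2 (dressedLiftFamily β φ g i) (transferApply β (dressedLiftFamily β φ g l)) = 0 ∧
      l2 (dressedLiftFamily β φ g l) (transferApply β (dressedLiftFamily β φ g i)) = 0 := by
  have key : ∀ a b : ℕ,
      l2 ((transferApply β)^[a] (OpPlat.ins φ (flowLiftAt (L := L) 0 (flowTime β L) (g i))))
        ((transferApply β)^[b] (OpPlat.ins φ (flowLiftAt 0 (flowTime β L) (g l)))) = 0 := fun a b =>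
    l2_iterIns_eq_zero_of_twirl β hφ (flowTime β L) γ ι hγι hphys a b (fun j F H hF hH => hinv j F H hF hH a b) w hw (hg i) (hg l) hfix hann
  refine ⟨?_, ?_, ?_⟩
  · rw [l2_dressed_eq_iterIns]; exact key _ _
  · rw [l2_dressed_transferApply_eq_iterIns]; exact key _ _
  · rw [l2_dressed_transferApply_eq_iterIns, l2_comm]; exact key _ _

/-- ★★ **Clauses (o2) (`StaticClauses`, S-STAT) and (o6) (`DynamicCoreClauses`, S-POS) of the registered texts hold with ANY `C ≥ 0` for a
twirl-separated pair of channels of a lift basis** (VERBATIM inequalities of p523114; raw vacuum `φ`). [cite: Luscher1983, §2] [cite: LuscherWolff1990] -/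
theorem dressedLiftFamily_o2_o6_of_twirl (β : ℝ) {φ : GaugeConfig 3 L SU2 → ℝ} (hvac : IsRawVacuum β φ)
    (γ : J → GaugeConfig 3 1 SU2 → GaugeConfig 3 1 SU2) (ι : J ≃ J) (hγι : ∀ j V, γ j (γ (ι j) V) = V)
    (hphys : ∀ j (F : GaugeConfig 3 1 SU2 → ℝ), IsPhys F → IsPhys fun V => F (γ j V))
    (hinv : ∀ j (F H : GaugeConfig 3 1 SU2 → ℝ), IsPhys F → IsPhys H → ∀ a b : ℕ,
      l2 ((transferApply β)^[a] (OpPlat.ins φ (flowLiftAt (L := L) 0 (flowTime β L) fun V => F (γ j V))))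
          ((transferApply β)^[b] (OpPlat.ins φ (flowLiftAt 0 (flowTime β L) fun V => H (γ j V)))) =
        l2 ((transferApply β)^[a] (OpPlat.ins φ (flowLiftAt (L := L) 0 (flowTime β L) F)))
          ((transferApply β)^[b] (OpPlat.ins φ (flowLiftAt 0 (flowTime β L) H))))
    (w : J → ℝ) (hw : ∀ j, w (ι j) = w j)
    {B : ℝ} {k : ℕ} {ω : GaugeConfig 3 1 SU2 → ℝ} {g : Fin k → (GaugeConfig 3 1 SU2 → ℝ)} (hbasis : LiftBasis B k ω g)
    {C : ℝ} (hC : 0 ≤ C) (i l : Fin k)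
    (hfix : ∀ V, ∑ j, w j * g i (γ j V) = g i V) (hann : ∀ V, ∑ j, w j * g l (γ j V) = 0) :
    |l2 (dressedLiftFamily β φ g i) (dressedLiftFamily β φ g l)| ≤
        C * luscherLambda β L *
          (Real.sqrt (l2 (dressedLiftFamily β φ g i) (dressedLiftFamily β φ g i)) *
            Real.sqrt (l2 (dressedLiftFamily β φ g l) (dressedLiftFamily β φ g l))) ∧
      |l2 (dressedLiftFamily β φ g i) (transferApply β (dressedLiftFamily β φ g l)) -
          (l2 (dressedLiftFamily β φ g i) (transferApply β (dressedLiftFamily β φ g i)) /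
                l2 (dressedLiftFamily β φ g i) (dressedLiftFamily β φ g i) +
              l2 (dressedLiftFamily β φ g l) (transferApply β (dressedLiftFamily β φ g l)) /
                l2 (dressedLiftFamily β φ g l) (dressedLiftFamily β φ g l)) / 2 *
            l2 (dressedLiftFamily β φ g i) (dressedLiftFamily β φ g l)|
        ≤ C * (luscherLambda β L ^ 2 / L) * levelValue su2Rep L β 0 *
            (Real.sqrt (l2 (dressedLiftFamily β φ g i) (dressedLiftFamily β φ g i)) *
              Real.sqrt (l2 (dressedLiftFamily β φ g l) (dressedLiftFamily β φ g l))) := by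
  obtain ⟨hφ, -, -⟩ := hvac
  have hg : ∀ j, IsPhys (g j) := hbasis.2.2.2.2.1
  obtain ⟨h0, h1, -⟩ := l2_dressed_pair_eq_zero_of_twirl β hφ γ ι hγι hphys hinv w hw hg i l hfix hann
  have hl0 : 0 ≤ levelValue su2Rep L β 0 := by rw [levelValue_zero]; exact topValue_nonneg su2Rep L β
  have hs : 0 ≤ Real.sqrt (l2 (dressedLiftFamily β φ g i) (dressedLiftFamily β φ g i)) *
      Real.sqrt (l2 (dressedLiftFamily β φ g l) (dressedLiftFamily β φ g l)) := mul_nonneg (Real.sqrt_nonneg _) (Real.sqrt_nonneg _)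
  refine ⟨?_, ?_⟩
  · rw [h0, abs_zero]
    exact mul_nonneg (mul_nonneg hC (KTRCalibration.luscherLambda_nonneg β L)) hs
  · rw [h1, h0, mul_zero, sub_zero, abs_zero]
    exact mul_nonneg (mul_nonneg (mul_nonneg hC (div_nonneg (sq_nonneg _) (Nat.cast_nonneg _))) hl0) hs

/-- ★★ **INVOLUTION ZERO.**  Let `σ` be an involutive one-site map (`σ ∘ σ = id`) preserving physicality and leaving the two-time forms at flow time
`L²/√λ` invariant (raw vacuum `φ`).  If the channel `g_i` is `σ`-EVEN and `g_l` is `σ`-ODD (`g_i ∘ σ = g_i`, `g_l ∘ σ = −g_l`), then clause (o2) of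
`StaticClauses` (S-STAT) and clause (o6) of `DynamicCoreClauses` (S-POS) hold for the pair with ANY `C ≥ 0` — the dressed channels are exactly
uncorrelated and uncoupled (twirl over `{id, σ}` with weights `½, ½`). [cite: Luscher1983, §2] [cite: LuscherWolff1990] -/
theorem dressedLiftFamily_o2_o6_of_involution (β : ℝ) {φ : GaugeConfig 3 L SU2 → ℝ} (hvac : IsRawVacuum β φ)
    (σ : GaugeConfig 3 1 SU2 → GaugeConfig 3 1 SU2) (hσ : ∀ V, σ (σ V) = V)
    (hσphys : ∀ F : GaugeConfig 3 1 SU2 → ℝ, IsPhys F → IsPhys fun V => F (σ V))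
    (hσinv : ∀ (F H : GaugeConfig 3 1 SU2 → ℝ) (a b : ℕ),
      l2 ((transferApply β)^[a] (OpPlat.ins φ (flowLiftAt (L := L) 0 (flowTime β L) fun V => F (σ V))))
          ((transferApply β)^[b] (OpPlat.ins φ (flowLiftAt 0 (flowTime β L) fun V => H (σ V)))) =
        l2 ((transferApply β)^[a] (OpPlat.ins φ (flowLiftAt (L := L) 0 (flowTime β L) F)))
          ((transferApply β)^[b] (OpPlat.ins φ (flowLiftAt 0 (flowTime β L) H))))
    {B : ℝ} {k : ℕ} {ω : GaugeConfig 3 1 SU2 → ℝ} {g : Fin k → (GaugeConfig 3 1 SU2 → ℝ)} (hbasis : LiftBasis B k ω g)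
    {C : ℝ} (hC : 0 ≤ C) (i l : Fin k)
    (heven : ∀ V, g i (σ V) = g i V) (hodd : ∀ V, g l (σ V) = -g l V) :
    |l2 (dressedLiftFamily β φ g i) (dressedLiftFamily β φ g l)| ≤
        C * luscherLambda β L *
          (Real.sqrt (l2 (dressedLiftFamily β φ g i) (dressedLiftFamily β φ g i)) *
            Real.sqrt (l2 (dressedLiftFamily β φ g l) (dressedLiftFamily β φ g l))) ∧
      |l2 (dressedLiftFamily β φ g i) (transferApply β (dressedLiftFamily β φ g l)) -
          (l2 (dressedLiftFamily β φ g i) (transferApply β (dressedLiftFamily β φ g i)) /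
                l2 (dressedLiftFamily β φ g i) (dressedLiftFamily β φ g i) +
              l2 (dressedLiftFamily β φ g l) (transferApply β (dressedLiftFamily β φ g l)) /
                l2 (dressedLiftFamily β φ g l) (dressedLiftFamily β φ g l)) / 2 *
            l2 (dressedLiftFamily β φ g i) (dressedLiftFamily β φ g l)|
        ≤ C * (luscherLambda β L ^ 2 / L) * levelValue su2Rep L β 0 *
            (Real.sqrt (l2 (dressedLiftFamily β φ g i) (dressedLiftFamily β φ g i)) *
              Real.sqrt (l2 (dressedLiftFamily β φ g l) (dressedLiftFamily β φ g l))) := by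
  let γ : Bool → GaugeConfig 3 1 SU2 → GaugeConfig 3 1 SU2 := fun c V => bif c then σ V else V
  have hγ : ∀ c V, γ c (γ c V) = V := fun c V => by
    cases c
    · rfl
    · simp only [γ, cond_true, hσ]
  have hphys : ∀ c (F : GaugeConfig 3 1 SU2 → ℝ), IsPhys F → IsPhys fun V => F (γ c V) := fun c F hF => by
    cases c
    · exact hF
    · exact hσphys F hF
  have hinv : ∀ c (F H : GaugeConfig 3 1 SU2 → ℝ), IsPhys F → IsPhys H → ∀ a b : ℕ,
      l2 ((transferApply β)^[a] (OpPlat.ins φ (flowLiftAt (L := L) 0 (flowTime β L) fun V => F (γ c V))))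
          ((transferApply β)^[b] (OpPlat.ins φ (flowLiftAt 0 (flowTime β L) fun V => H (γ c V)))) =
        l2 ((transferApply β)^[a] (OpPlat.ins φ (flowLiftAt (L := L) 0 (flowTime β L) F)))
          ((transferApply β)^[b] (OpPlat.ins φ (flowLiftAt 0 (flowTime β L) H))) := fun c F H _ _ a b => by
    cases c
    · rfl
    · exact hσinv F H a b
  refine dressedLiftFamily_o2_o6_of_twirl β hvac γ (Equiv.refl Bool) (fun c V => hγ c V) hphys hinv (fun _ => (1 / 2 : ℝ)) (fun _ => rfl)
    hbasis hC i l (fun V => ?_) (fun V => ?_)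
  · simp only [γ, Fintype.sum_bool, cond_true, cond_false, heven]; ring
  · simp only [γ, Fintype.sum_bool, cond_true, cond_false, hodd]; ring

/-- ★★ **PARITY ZERO under `Θ'₁`** — the first symmetry zero beyond `S₃`: a channel EVEN and a channel ODD under the one-site reflection `Θ'₁`
(inversion of the link along axis `0`) are exactly uncorrelated and uncoupled for every raw vacuum; (o2) and (o6) hold for the pair with ANY `C ≥ 0`.
[cite: Luscher1983, §2] [cite: LuscherMunster1984, §2] -/
theorem dressedLiftFamily_o2_o6_of_parity (β : ℝ) {φ : GaugeConfig 3 L SU2 → ℝ} (hvac : IsRawVacuum β φ)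
    {B : ℝ} {k : ℕ} {ω : GaugeConfig 3 1 SU2 → ℝ} {g : Fin k → (GaugeConfig 3 1 SU2 → ℝ)} (hbasis : LiftBasis B k ω g)
    {C : ℝ} (hC : 0 ≤ C) (i l : Fin k)
    (heven : ∀ V, g i V.negReflect = g i V) (hodd : ∀ V, g l V.negReflect = -g l V) :
    |l2 (dressedLiftFamily β φ g i) (dressedLiftFamily β φ g l)| ≤
        C * luscherLambda β L *
          (Real.sqrt (l2 (dressedLiftFamily β φ g i) (dressedLiftFamily β φ g i)) *
            Real.sqrt (l2 (dressedLiftFamily β φ g l) (dressedLiftFamily β φ g l))) ∧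
      |l2 (dressedLiftFamily β φ g i) (transferApply β (dressedLiftFamily β φ g l)) -
          (l2 (dressedLiftFamily β φ g i) (transferApply β (dressedLiftFamily β φ g i)) /
                l2 (dressedLiftFamily β φ g i) (dressedLiftFamily β φ g i) +
              l2 (dressedLiftFamily β φ g l) (transferApply β (dressedLiftFamily β φ g l)) /
                l2 (dressedLiftFamily β φ g l) (dressedLiftFamily β φ g l)) / 2 *
            l2 (dressedLiftFamily β φ g i) (dressedLiftFamily β φ g l)|
        ≤ C * (luscherLambda β L ^ 2 / L) * levelValue su2Rep L β 0 *
            (Real.sqrt (l2 (dressedLiftFamily β φ g i) (dressedLiftFamily β φ g i)) *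
              Real.sqrt (l2 (dressedLiftFamily β φ g l) (dressedLiftFamily β φ g l))) :=
  dressedLiftFamily_o2_o6_of_involution β hvac (fun V => V.negReflect) WilsonSiteRP.negReflect_negReflect_config
    (fun _ hF => hF.comp_negReflect) (fun F H a b => l2_iterIns_comp_negReflect β hvac.1 hvac.2.2 (flowTime β L) F H a b)
    hbasis hC i l heven hodd

/-- ★ **TRANSPOSITION ZERO**: a channel EVEN and a channel ODD under one axis TRANSPOSITION `(μ ν) ∈ S₃` are exactly uncorrelated and uncoupled;
(o2) and (o6) hold for the pair with ANY `C ≥ 0` (e.g. the `(12)`-even member of a `T₂` triplet against the `(12)`-odd member of a `T₁` triplet, which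
share all reflection parities). [cite: Luscher1983, §2] -/
theorem dressedLiftFamily_o2_o6_of_transposition (β : ℝ) {φ : GaugeConfig 3 L SU2 → ℝ} (hvac : IsRawVacuum β φ) (μ ν : Fin 3)
    {B : ℝ} {k : ℕ} {ω : GaugeConfig 3 1 SU2 → ℝ} {g : Fin k → (GaugeConfig 3 1 SU2 → ℝ)} (hbasis : LiftBasis B k ω g)
    {C : ℝ} (hC : 0 ≤ C) (i l : Fin k)
    (heven : ∀ V, g i (configPerm (Equiv.swap μ ν) V) = g i V) (hodd : ∀ V, g l (configPerm (Equiv.swap μ ν) V) = -g l V) :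
    |l2 (dressedLiftFamily β φ g i) (dressedLiftFamily β φ g l)| ≤
        C * luscherLambda β L *
          (Real.sqrt (l2 (dressedLiftFamily β φ g i) (dressedLiftFamily β φ g i)) *
            Real.sqrt (l2 (dressedLiftFamily β φ g l) (dressedLiftFamily β φ g l))) ∧
      |l2 (dressedLiftFamily β φ g i) (transferApply β (dressedLiftFamily β φ g l)) -
          (l2 (dressedLiftFamily β φ g i) (transferApply β (dressedLiftFamily β φ g i)) /
                l2 (dressedLiftFamily β φ g i) (dressedLiftFamily β φ g i) +
              l2 (dressedLiftFamily β φ g l) (transferApply β (dressedLiftFamily β φ g l)) /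
                l2 (dressedLiftFamily β φ g l) (dressedLiftFamily β φ g l)) / 2 *
            l2 (dressedLiftFamily β φ g i) (dressedLiftFamily β φ g l)|
        ≤ C * (luscherLambda β L ^ 2 / L) * levelValue su2Rep L β 0 *
            (Real.sqrt (l2 (dressedLiftFamily β φ g i) (dressedLiftFamily β φ g i)) *
              Real.sqrt (l2 (dressedLiftFamily β φ g l) (dressedLiftFamily β φ g l))) := by
  refine dressedLiftFamily_o2_o6_of_involution β hvac (fun V => configPerm (Equiv.swap μ ν) V) (fun V => ?_)
    (fun _ hF => hF.comp_configPerm _) (fun F H a b => l2_iterIns_comp_configPerm β hvac.1 hvac.2.2 _ (flowTime β L) F H a b)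
    hbasis hC i l heven hodd
  funext e
  simp only [configPerm_apply, Equiv.symm_swap, Equiv.swap_apply_self]
  congr 1
  exact Prod.ext (funext fun j => by simp only [sitePerm_apply, Equiv.symm_swap, Equiv.swap_apply_self]) rfl

end Dressed

end Summit.QuantumFields.YangMills.Theorems.FemtoTransferGap.PolyakovLift

end
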